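import Mathlib
import Summits.ResolutionOfSingularities.ResolutionOfSingularities.Theorems.WeightedInvariantLocalWeightedDropTOT2CurveConflictDivTwo

/-!
# `LocalWeightedDrop`, NC count game — TOT2-LINE piece S-CRV (v1.3 (P3)/(B2)): a graph branch is DETERMINED BY ITS DATUM `h` — uniqueness of the
# `u₂`-free re-centring

[OURS · L1 W4.3 · chain w43, engine crux `LocalWeightedDrop` stmt-ResolutionOfSingularities-8899; piece S-CRV / (P3) = res-type-088; `--supports 8899 --as helper`,
counted 0; definition-free; nothing here is a statement of any manuscript; AI-written (gate-accepted = sorry-free with standard axioms, not refereed).]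

The conflict budget (B2) of TOT2-LINE v1.3 is indexed by the graph DATA `h` of a label.  This file justifies that indexing: for a fixed label `B`
(think `B = shearT h A`) at most ONE `u₂`-free re-centring `φ` makes `V(y,u₂)` permissible for `shift d B φ` (`d ≥ 1`), so the branch
`V(y + φ, ũ₂)` with datum `h` is unique — two top-locus branches inside the same plane `ũ₂ = 0` would force the plane section of the monic form,
of degree `d` in `y`, to be divisible by `(y + φ)^d (y + φ′)^d`.
* `map_killTwo_monicPoly_eq_pow` — the branch congruence: if `V(y,u₂)` is permissible for `shift d B φ` with `φ` `u₂`-free, then reducing the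
  monic form of `B` mod `u₂` gives `(Y − φ)^d` (`Polynomial.map killTwo`; the tool behind F6);
* **`killTwo_recentring_unique`** — `IsPermissibleTwoT d (shift d B ψ)` and `IsPermissibleTwoT d (shift d B ψ′)` imply `ψ(u₁,0) = ψ′(u₁,0)`;
* `graph_datum_recentring_unique` — the same for graph data `(h, ψ)`, `(h, ψ′)` of a label `A`.
-/

set_option linter.dupNamespace false -- mandated namespace of this single-conjunct summit

noncomputable section

namespace Summit.ResolutionOfSingularities.ResolutionOfSingularities.Theorems

namespace TOT2Curve

open MvPowerSeries PolyDescent MonicDescent WildMonic Literature.AlgebraicGeometry.Resolution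

variable {k : Type} [Field k] {d : ℕ}

/-- **THE BRANCH CONGRUENCE.**  If `V(y,u₂)` is permissible for the re-centred label `shift d B φ` with `φ` `u₂`-free, then for every ring map
`K` that agrees with the `u₂`-free part `killTwo`, the monic form of `B` reduces to `(Y − φ)^d`. -/
theorem map_killTwo_monicPoly_eq_pow (B : Fin d → MvPowerSeries (Fin 2) k) (φ : MvPowerSeries (Fin 2) k)
    (hφ : ∀ e : Fin 2 →₀ ℕ, e 1 ≠ 0 → coeff e φ = 0) (hperm : IsPermissibleTwoT d (shift d B φ))
    (K : MvPowerSeries (Fin 2) k →+* MvPowerSeries (Fin 2) k) (hK : ∀ F, K F = subst (![X 0, 0] : Fin 2 → MvPowerSeries (Fin 2) k) F) :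
    (monicPoly d B).map K = (Polynomial.X + Polynomial.C (-φ)) ^ d := by
  set S := shift d B φ with hS
  have hSdvd : ∀ j : Fin d, X 1 ^ (d - (j : ℕ)) ∣ S j := (isPermissibleTwoT_iff_X_pow_dvd S).mp hperm
  have hKS : ∀ j : Fin d, K (S j) = 0 := fun j => by
    rw [hK, ← X_one_dvd_iff_killTwo_eq_zero]
    exact (dvd_pow_self _ (by have := j.2; omega)).trans (hSdvd j)
  have hKφ : K φ = φ := by rw [hK, killTwo_of_noY φ hφ]
  have hP : monicPoly d B = Polynomial.taylor (-φ) (monicPoly d S) := by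
    rw [taylor_monicPoly, hS, PolyDescent.shift_shift_neg]
  have hmapS : (monicPoly d S).map K = Polynomial.X ^ d := by
    unfold monicPoly
    rw [Polynomial.map_add, Polynomial.map_pow, Polynomial.map_X, Polynomial.map_sum]
    simp only [Polynomial.map_mul, Polynomial.map_C, hKS, map_zero, zero_mul, Finset.sum_const_zero, add_zero]
  rw [hP, Polynomial.taylor_apply, Polynomial.map_comp, hmapS, Polynomial.map_add, Polynomial.map_X, Polynomial.map_C, map_neg, hKφ,
    Polynomial.X_pow_comp]

/-- **UNIQUENESS OF THE `u₂`-FREE RE-CENTRING** (`d ≥ 1`): if `V(y,u₂)` is permissible for `shift d B ψ` and for `shift d B ψ′`, then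
`ψ(u₁,0) = ψ′(u₁,0)`.  (Both `u₂`-free parts satisfy the branch congruence; evaluate `(Y − φ)^d = (Y − φ′)^d` at `Y = φ`.) -/
theorem killTwo_recentring_unique (hd : 0 < d) (B : Fin d → MvPowerSeries (Fin 2) k) (ψ ψ' : MvPowerSeries (Fin 2) k)
    (hperm : IsPermissibleTwoT d (shift d B ψ)) (hperm' : IsPermissibleTwoT d (shift d B ψ')) :
    subst (![X 0, 0] : Fin 2 → MvPowerSeries (Fin 2) k) ψ = subst (![X 0, 0] : Fin 2 → MvPowerSeries (Fin 2) k) ψ' := by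
  obtain ⟨K, hK⟩ : ∃ K : MvPowerSeries (Fin 2) k →+* MvPowerSeries (Fin 2) k,
      ∀ F, K F = subst (![X 0, 0] : Fin 2 → MvPowerSeries (Fin 2) k) F :=
    ⟨(substAlgHom (hasSubst_killTwo (k := k))).toRingHom, fun F => by
      rw [AlgHom.toRingHom_eq_coe, RingHom.coe_coe, coe_substAlgHom]⟩
  set φ := subst (![X 0, 0] : Fin 2 → MvPowerSeries (Fin 2) k) ψ with hφ
  set φ' := subst (![X 0, 0] : Fin 2 → MvPowerSeries (Fin 2) k) ψ' with hφ'
  have hφ_noY : ∀ e : Fin 2 →₀ ℕ, e 1 ≠ 0 → coeff e φ = 0 := fun e he => by rw [hφ, coeff_subst_killTwo, if_neg he]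
  have hφ'_noY : ∀ e : Fin 2 →₀ ℕ, e 1 ≠ 0 → coeff e φ' = 0 := fun e he => by rw [hφ', coeff_subst_killTwo, if_neg he]
  have h1 := map_killTwo_monicPoly_eq_pow B φ hφ_noY (isPermissibleTwoT_shift_killTwo hperm) K hK
  have h2 := map_killTwo_monicPoly_eq_pow B φ' hφ'_noY (isPermissibleTwoT_shift_killTwo hperm') K hK
  have h3 : ((Polynomial.X + Polynomial.C (-φ)) ^ d : Polynomial (MvPowerSeries (Fin 2) k)).eval φ =
      ((Polynomial.X + Polynomial.C (-φ')) ^ d).eval φ := by rw [← h1, ← h2]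
  simp only [Polynomial.eval_pow, Polynomial.eval_add, Polynomial.eval_X, Polynomial.eval_C, add_neg_cancel,
    zero_pow hd.ne'] at h3
  have h4 : φ + -φ' = 0 := (pow_eq_zero_iff hd.ne').mp h3.symm
  exact (add_neg_eq_zero.mp h4)

/-- For graph data: two re-centrings presenting graph branches of `A` with the SAME datum `h` have the same `u₂`-free part — the branch
`V(y + ψ(u₁,0), u₂ + u₁h)` is determined by `h`. -/
theorem graph_datum_recentring_unique (hd : 0 < d) (A : Fin d → MvPowerSeries (Fin 2) k) (h ψ ψ' : MvPowerSeries (Fin 2) k)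
    (hperm : IsPermissibleTwoT d (shift d (shearT h A) ψ)) (hperm' : IsPermissibleTwoT d (shift d (shearT h A) ψ')) :
    subst (![X 0, 0] : Fin 2 → MvPowerSeries (Fin 2) k) ψ = subst (![X 0, 0] : Fin 2 → MvPowerSeries (Fin 2) k) ψ' :=
  killTwo_recentring_unique hd (shearT h A) ψ ψ' hperm hperm'

end TOT2Curve

end Summit.ResolutionOfSingularities.ResolutionOfSingularities.Theorems

end
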